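import Summits.AtomisticToContinuum.Crystallization.Theorems.ContactSaturationLadderChunkDoor
import Summits.AtomisticToContinuum.Crystallization.Theorems.ContactSaturationLadderFractionTransfer
import HarnessLib

/-!
# ContactSaturationLadderChunkProfile — the ORDER STRUCTURE of the residual pair of crux `LooseTextureRung`, part 2 of 3:
the loss-free transfer K5♯ and the marked-fraction profile `Φ_F(ρ) → Φ_∞(F)` (helper, supports item 30303)

Helper for route `ContactSaturationLadder` (sub-problem `Crystallization`), crux `LooseTextureRung`
(stmt-AtomisticToContinuum-30303, DECLARED RESIDUAL-CORE), registered line «DialFreeSieveV6» v6.3 (lens-1 lineage `decomp-a2c-lens-1`,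
cell `decomp-a2c`; the registered skeleton and its stubs are UNTOUCHED — nothing here is a registered item).  LANDING PICKED by the cell
critic (`decomp-a2c-crit-1`, CRITIC-LEDGER row 283 (ε), bus STATUS l.1402): «Theorems landing of the GS-free, route-independent §30/§31
order lemmas (recentring kernel, door ⟹ rung, NLC ⟺ ∃ r NoLooseChunkAt r, NLC ⟺ NEAR(φ) ∧ Φ_∞ < φ, DIP ⟸ FCE) as a helper».  Source: the
lineage node g23 (`LooseTextureRung_node_g23.lean`, sha256 d04ae943…, §24–§31, kernel-checked there against the tree item).  Every statement
below is PROVED (0 sorry, standard axioms).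
PART 2 (this file) continues PART 1 `ContactSaturationLadderChunkDoor` (same namespace; marker-generic, Theses-free — see its header).
The fraction transfer is the TREE lemma `ContactSaturationLadderFractionTransfer.card_le_of_localFraction_fill` (p797976), combined with
PART 1's cubed filling `ρ³ ≤ 8·#B` and the TREE separation `7/10`.

## Contents

§4 (continued) K5♯ — the LOSS-FREE TRANSFER between radii: `NoMarkedChunkAt F ρ φ → NoMarkedChunkAt F ρ₁ (φ·(1 + 2304·δ⁻³·ρ/ρ₁))` at a named
   separation `δ ≤ 1`, hence with the explicit constant `6720` (`δ = 7/10`), for `1 ≤ ρ`, `3ρ ≤ ρ₁`, `18 ≤ ρ₁`; the effective radius for a fraction.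
§5 THE PROFILE `markedProfile F ρ = Φ_F(ρ)` (the attained infimum of admissible fractions at radius `ρ`, in `[0,1]`) and the NUMBER
   `markedProfileInf F = Φ_∞(F)` (infimum over `ρ ≥ 1` = the LIMIT, `tendsto_markedProfile`): profile form of K5♯, convergence,
   exclusion ⟺ `Φ_∞ = 0` ⟺ one radius per fraction, `Φ_∞ < t` witnessed at one radius, every rung / open implant door at ONE radius `ρ ≥ 1`
   bounds `Φ_∞`, «`Φ_∞ < φ`» ⟸ exclusion, and NLC / a radius rung make the profile vanish.
-/

noncomputable section

open scoped BigOperators Topology Classical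
open Filter Metric
open Literature.MathematicalPhysics.StatisticalMechanics (lennardJones IsGroundState)
open Summit.AtomisticToContinuum.Crystallization.Theorems
open Summit.AtomisticToContinuum.Crystallization.Theorems.ContactSaturationLadderHaloCount (looseSet voidAdjSet)
open Summit.AtomisticToContinuum.Crystallization.Theorems.ContactSaturationLadderFractionTransfer (card_le_of_localFraction_fill)
open Summit.AtomisticToContinuum.Crystallization.Theorems.LjLaminarWindowsSketch (lennardJones_groundState_dist_ge_seven_tenths)

namespace Summit.AtomisticToContinuum.Crystallization.Theorems.ContactSaturationLadderChunkDoor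

/-! ### K5♯: the loss-free transfer between radii (TREE `card_le_of_localFraction_fill`) -/

/-- **K5♯ at a named separation** (`δ ≤ 1`, every ground state `δ`-separated):
`NoMarkedChunkAt F ρ φ → NoMarkedChunkAt F ρ₁ (φ·(1 + 2304·δ⁻³·ρ/ρ₁))` for `1 ≤ ρ`, `3ρ ≤ ρ₁`, `18 ≤ ρ₁`, `0 ≤ φ`
[`2304 = 288·8`: collar count × cubed filling]. -/
theorem noMarkedChunkAt_transfer_of_sep {δ : ℝ} (hδ : 0 < δ) (hδ1 : δ ≤ 1)
    (hsepGS : ∀ (N : ℕ) (y : Fin N → EuclideanSpace ℝ (Fin 3)), IsGroundState lennardJones y →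
      ∀ i j : Fin N, i ≠ j → δ ≤ dist (y i) (y j))
    {F : SiteMarker} {ρ φ : ℝ} (hρ : 1 ≤ ρ) (hφ : 0 ≤ φ) (h : NoMarkedChunkAt F ρ φ) {ρ₁ : ℝ} (h3 : 3 * ρ ≤ ρ₁) (h18 : 18 ≤ ρ₁) :
    NoMarkedChunkAt F ρ₁ (φ * (1 + 2304 * δ⁻¹ ^ 3 * (ρ / ρ₁))) := by
  intro N y hy c hl hv
  set B₁ := Finset.univ.filter (fun i : Fin N => dist (y i) c ≤ ρ₁) with hB₁
  set Fm := Finset.univ.filter (fun i : Fin N => dist (y i) c ≤ ρ₁ ∧ i ∈ F N y) with hFdef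
  -- the local fraction bound: the rung applies at every window centred within ρ₁ + ρ of c (admissibility inherits downward)
  have hF : ∀ i ∈ Fm, dist (y i) c ≤ ρ₁ := fun i hi => (Finset.mem_filter.mp hi).2.1
  have hloc : ∀ p : EuclideanSpace ℝ (Fin 3), dist p c ≤ ρ₁ + ρ →
      ((Fm.filter fun i : Fin N => dist (y i) p ≤ ρ).card : ℝ) ≤ φ * ((Finset.univ.filter fun i : Fin N => dist (y i) p ≤ ρ).card : ℝ) := by
    intro p hp
    have hwin : ∀ i : Fin N, dist (y i) p ≤ 2 * ρ → dist (y i) c ≤ 2 * ρ₁ := by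
      intro i hi
      have := dist_triangle (y i) p c
      linarith
    have hrung := h N y hy p (fun i hi => hl i (hwin i hi)) (fun i hi => hv i (hwin i hi))
    refine le_trans ?_ hrung
    exact_mod_cast Finset.card_le_card fun i hi => by
      simp only [Finset.mem_filter, Finset.mem_univ, true_and, hFdef] at hi ⊢
      exact ⟨hi.2, hi.1.2⟩
  -- empty inner window: nothing to prove; else filling ρ₁³ ≤ 8·#B₁ and the TREE transfer lemma
  obtain hempty | hne := (B₁ : Finset (Fin N)).eq_empty_or_nonempty
  · have hF0 : Fm = ∅ := Finset.eq_empty_of_forall_notMem fun i hi => by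
      have : i ∈ B₁ := Finset.mem_filter.mpr ⟨Finset.mem_univ _, (Finset.mem_filter.mp hi).2.1⟩
      rw [hempty] at this
      exact absurd this (Finset.notMem_empty _)
    rw [hF0, hempty, Finset.card_empty, Nat.cast_zero, mul_zero]
  · obtain ⟨i₀, hi₀⟩ := hne
    have hcube := cube_le_eight_mul_card_of_voidFree (by linarith) hv ⟨i₀, (Finset.mem_filter.mp hi₀).2⟩
    have hsep : ∀ k l : Fin N, k ≠ l → δ ≤ dist (y k) (y l) := fun k l hkl => hsepGS N y hy k l hkl
    have ht := card_le_of_localFraction_fill y hδ hδ1 hsep c hρ h3 h18 hφ hcube Fm hF hloc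
    have e : (288 : ℝ) * 8 * δ⁻¹ ^ 3 * (ρ / ρ₁) = 2304 * δ⁻¹ ^ 3 * (ρ / ρ₁) := by norm_num
    rw [e] at ht
    exact ht

/-- **K5♯ with EXPLICIT numerals** (separation `7/10` from the TREE): `NoMarkedChunkAt F ρ φ → NoMarkedChunkAt F ρ₁ (φ·(1 + 6720·ρ/ρ₁))`
for `1 ≤ ρ`, `3ρ ≤ ρ₁`, `18 ≤ ρ₁`, `0 ≤ φ` (`2304·(10/7)³ ≤ 6720`). -/
theorem noMarkedChunkAt_transfer_explicit {F : SiteMarker} {ρ φ : ℝ} (hρ : 1 ≤ ρ) (hφ : 0 ≤ φ) (h : NoMarkedChunkAt F ρ φ) {ρ₁ : ℝ}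
    (h3 : 3 * ρ ≤ ρ₁) (h18 : 18 ≤ ρ₁) : NoMarkedChunkAt F ρ₁ (φ * (1 + 6720 * (ρ / ρ₁))) := by
  have h1 := noMarkedChunkAt_transfer_of_sep (δ := 7 / 10) (by norm_num) (by norm_num)
    (fun N y hy i j hij => lennardJones_groundState_dist_ge_seven_tenths hy hij) hρ hφ h h3 h18
  refine noMarkedChunkAt_mono_phi ?_ h1
  have hρ₁ : 0 < ρ₁ := by linarith
  have hr : 0 ≤ ρ / ρ₁ := by positivity
  have hc : (2304 : ℝ) * ((7 : ℝ) / 10)⁻¹ ^ 3 ≤ 6720 := by norm_num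
  have : 2304 * ((7 : ℝ) / 10)⁻¹ ^ 3 * (ρ / ρ₁) ≤ 6720 * (ρ / ρ₁) := mul_le_mul_of_nonneg_right hc hr
  exact mul_le_mul_of_nonneg_left (by linarith) hφ

/-- **K5♯ · `noMarkedChunkAt_transfer`**: there is `C > 0` such that the rung at ONE radius `ρ ≥ 1` gives, at EVERY radius `ρ₁ ≥ max (3ρ) 18`,
the rung with fraction `φ·(1 + C·ρ/ρ₁)` — the loss factor tends to ONE. -/
theorem noMarkedChunkAt_transfer : ∃ C : ℝ, 0 < C ∧ ∀ (F : SiteMarker) (ρ φ : ℝ), 1 ≤ ρ → 0 ≤ φ → NoMarkedChunkAt F ρ φ →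
    ∀ ρ₁ : ℝ, 3 * ρ ≤ ρ₁ → 18 ≤ ρ₁ → NoMarkedChunkAt F ρ₁ (φ * (1 + C * (ρ / ρ₁))) :=
  ⟨6720, by norm_num, fun _ _ _ hρ hφ h _ h3 h18 => noMarkedChunkAt_transfer_explicit hρ hφ h h3 h18⟩

/-- **Effective radius for a fraction**: the rung at ONE radius `ρ ≥ 1` with HALF the fraction gives the rung with fraction `φ` at every
`ρ₁ ≥ max (3ρ) (max 18 (6720ρ))`. -/
theorem noMarkedChunkAt_of_half {F : SiteMarker} {ρ φ : ℝ} (hρ : 1 ≤ ρ) (hφ : 0 ≤ φ) (h : NoMarkedChunkAt F ρ (φ / 2)) {ρ₁ : ℝ}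
    (h3 : 3 * ρ ≤ ρ₁) (h18 : 18 ≤ ρ₁) (hC1 : 6720 * ρ ≤ ρ₁) : NoMarkedChunkAt F ρ₁ φ := by
  have h1 := noMarkedChunkAt_transfer_explicit hρ (by linarith) h h3 h18
  refine noMarkedChunkAt_mono_phi ?_ h1
  have hρ₁ : 0 < ρ₁ := by linarith
  have hle : 6720 * (ρ / ρ₁) ≤ 1 := by
    rw [mul_div_assoc', div_le_one hρ₁]
    exact hC1
  nlinarith

/-! ## §5 The profile `Φ_F(ρ)` and its limit `Φ_∞(F)` -/

/-- **`markedProfile F ρ = Φ_F(ρ)`** — the best fraction at radius `ρ`: the infimum of the `φ ≥ 0` for which the rung `NoMarkedChunkAt F ρ φ`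
holds (a number in `[0,1]`, ATTAINED: `noMarkedChunkAt_markedProfile`). -/
def markedProfile (F : SiteMarker) (ρ : ℝ) : ℝ := sInf {φ : ℝ | 0 ≤ φ ∧ NoMarkedChunkAt F ρ φ}

/-- The admissible fractions at a radius form a nonempty set (`1` is admissible). -/
theorem markedProfile_set_nonempty (F : SiteMarker) (ρ : ℝ) : ({φ : ℝ | 0 ≤ φ ∧ NoMarkedChunkAt F ρ φ} : Set ℝ).Nonempty :=
  ⟨1, zero_le_one, noMarkedChunkAt_of_one_le F ρ le_rfl⟩

/-- … bounded below by `0`. -/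
theorem markedProfile_set_bddBelow (F : SiteMarker) (ρ : ℝ) : BddBelow ({φ : ℝ | 0 ≤ φ ∧ NoMarkedChunkAt F ρ φ} : Set ℝ) :=
  ⟨0, fun _ hφ => hφ.1⟩

/-- `0 ≤ Φ_F(ρ)`. -/
theorem markedProfile_nonneg (F : SiteMarker) (ρ : ℝ) : 0 ≤ markedProfile F ρ :=
  le_csInf (markedProfile_set_nonempty F ρ) fun _ hφ => hφ.1

/-- Every rung at radius `ρ` bounds the profile there: `Φ_F(ρ) ≤ φ`. -/
theorem markedProfile_le_of_rung {F : SiteMarker} {ρ φ : ℝ} (hφ : 0 ≤ φ) (h : NoMarkedChunkAt F ρ φ) : markedProfile F ρ ≤ φ :=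
  csInf_le (markedProfile_set_bddBelow F ρ) ⟨hφ, h⟩

/-- `Φ_F(ρ) ≤ 1`. -/
theorem markedProfile_le_one (F : SiteMarker) (ρ : ℝ) : markedProfile F ρ ≤ 1 :=
  markedProfile_le_of_rung zero_le_one (noMarkedChunkAt_of_one_le F ρ le_rfl)

/-- **The profile is ATTAINED**: the rung holds at the fraction `Φ_F(ρ)` itself (each window's constraint is a closed condition in `φ`). -/
theorem noMarkedChunkAt_markedProfile (F : SiteMarker) (ρ : ℝ) : NoMarkedChunkAt F ρ (markedProfile F ρ) := by
  intro N y hy c hl hv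
  set a : ℝ := ((Finset.univ.filter fun i : Fin N => dist (y i) c ≤ ρ ∧ i ∈ F N y).card : ℝ) with ha
  set b : ℝ := ((Finset.univ.filter fun i : Fin N => dist (y i) c ≤ ρ).card : ℝ) with hb
  have hb0 : 0 ≤ b := by positivity
  have hall : ∀ φ : ℝ, markedProfile F ρ < φ → a ≤ φ * b := by
    intro φ hφ
    obtain ⟨φ', hφ'mem, hφ'lt⟩ := exists_lt_of_csInf_lt (markedProfile_set_nonempty F ρ) hφ
    exact le_trans (hφ'mem.2 N y hy c hl hv) (mul_le_mul_of_nonneg_right hφ'lt.le hb0)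
  refine le_of_forall_gt_imp_ge_of_dense fun t ht => ?_
  by_cases hb' : b = 0
  · have := hall (markedProfile F ρ + 1) (by linarith)
    rw [hb', mul_zero] at this ht
    linarith
  · have hbpos : 0 < b := lt_of_le_of_ne hb0 (Ne.symm hb')
    have hφ : markedProfile F ρ < t / b := by rw [lt_div_iff₀ hbpos]; linarith
    have := hall (t / b) hφ
    rwa [div_mul_cancel₀ t hb'] at this

/-- **Profile form of K5♯**: `Φ_F(ρ₁) ≤ Φ_F(ρ)·(1 + C·ρ/ρ₁)` for `1 ≤ ρ`, `max (3ρ) 18 ≤ ρ₁`. -/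
theorem markedProfile_transfer : ∃ C : ℝ, 0 < C ∧ ∀ (F : SiteMarker) (ρ ρ₁ : ℝ), 1 ≤ ρ → 3 * ρ ≤ ρ₁ → 18 ≤ ρ₁ →
    markedProfile F ρ₁ ≤ markedProfile F ρ * (1 + C * (ρ / ρ₁)) := by
  obtain ⟨C, hC, htr⟩ := noMarkedChunkAt_transfer
  refine ⟨C, hC, fun F ρ ρ₁ hρ h3 h18 => ?_⟩
  have h0 := markedProfile_nonneg F ρ
  have hfac : 0 ≤ 1 + C * (ρ / ρ₁) := by
    have : 0 ≤ C * (ρ / ρ₁) := by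
      have hρ₁ : 0 < ρ₁ := by linarith
      positivity
    linarith
  exact markedProfile_le_of_rung (mul_nonneg h0 hfac) (htr F ρ _ hρ h0 (noMarkedChunkAt_markedProfile F ρ) ρ₁ h3 h18)

/-- **`markedProfileInf F = Φ_∞(F)`** — the infimum of the profile over radii `ρ ≥ 1` (= its LIMIT, `tendsto_markedProfile`). -/
def markedProfileInf (F : SiteMarker) : ℝ := sInf (markedProfile F '' Set.Ici 1)

/-- `Φ_∞(F) ≤ Φ_F(ρ)` for every `ρ ≥ 1`. -/
theorem markedProfileInf_le_markedProfile {F : SiteMarker} {ρ : ℝ} (hρ : 1 ≤ ρ) : markedProfileInf F ≤ markedProfile F ρ :=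
  csInf_le ⟨0, by rintro _ ⟨ρ', -, rfl⟩; exact markedProfile_nonneg F ρ'⟩ ⟨ρ, hρ, rfl⟩

/-- `0 ≤ Φ_∞(F)`. -/
theorem markedProfileInf_nonneg (F : SiteMarker) : 0 ≤ markedProfileInf F :=
  le_csInf ⟨_, ⟨1, Set.mem_Ici.mpr le_rfl, rfl⟩⟩ (by rintro _ ⟨ρ', -, rfl⟩; exact markedProfile_nonneg F ρ')

/-- `Φ_∞(F) ≤ 1`. -/
theorem markedProfileInf_le_one (F : SiteMarker) : markedProfileInf F ≤ 1 :=
  (markedProfileInf_le_markedProfile le_rfl).trans (markedProfile_le_one F 1)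

/-- **CONVERGENCE OF THE PROFILE**: `Φ_F(ρ) → Φ_∞(F)` as `ρ → ∞` — by K5♯ the profile is asymptotically non-increasing. -/
theorem tendsto_markedProfile (F : SiteMarker) : Tendsto (markedProfile F) atTop (nhds (markedProfileInf F)) := by
  obtain ⟨C, hC, htr⟩ := markedProfile_transfer
  rw [Metric.tendsto_atTop]
  intro ε hε
  -- a radius ρ ≥ 1 with Φ(ρ) < Φ_∞ + ε/2
  have hlt : sInf (markedProfile F '' Set.Ici 1) < markedProfileInf F + ε / 2 := by
    show markedProfileInf F < markedProfileInf F + ε / 2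
    linarith
  obtain ⟨_, ⟨ρ, hρ, rfl⟩, hΦρ⟩ :=
    exists_lt_of_csInf_lt (⟨_, ⟨1, Set.mem_Ici.mpr le_rfl, rfl⟩⟩ : (markedProfile F '' Set.Ici 1).Nonempty) hlt
  have hρ1 : (1 : ℝ) ≤ ρ := hρ
  -- beyond max (3ρ) 18 and beyond 2Cρ/ε the loss term is < ε/2
  refine ⟨max (max (3 * ρ) 18) (2 * C * ρ / ε + 1), fun ρ₁ hρ₁ => ?_⟩
  have h3 : 3 * ρ ≤ ρ₁ := le_trans (le_trans (le_max_left _ _) (le_max_left _ _)) hρ₁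
  have h18 : 18 ≤ ρ₁ := le_trans (le_trans (le_max_right _ _) (le_max_left _ _)) hρ₁
  have hbig : 2 * C * ρ / ε < ρ₁ := lt_of_lt_of_le (by linarith) (le_trans (le_max_right _ _) hρ₁)
  have hρ₁0 : 0 < ρ₁ := by linarith
  have hup := htr F ρ ρ₁ hρ1 h3 h18
  have hlow : markedProfileInf F ≤ markedProfile F ρ₁ := markedProfileInf_le_markedProfile (by linarith)
  have hΦ0 := markedProfile_nonneg F ρ
  have hΦ1 := markedProfile_le_one F ρ
  have hloss : markedProfile F ρ * (C * (ρ / ρ₁)) < ε / 2 := by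
    have h1 : C * (ρ / ρ₁) < ε / 2 := by
      rw [div_lt_iff₀ hε] at hbig
      have : C * ρ < ε / 2 * ρ₁ := by linarith
      calc C * (ρ / ρ₁) = C * ρ / ρ₁ := by ring
        _ < ε / 2 := by rw [div_lt_iff₀ hρ₁0]; linarith
    have h2 : 0 ≤ C * (ρ / ρ₁) := by positivity
    calc markedProfile F ρ * (C * (ρ / ρ₁)) ≤ 1 * (C * (ρ / ρ₁)) := mul_le_mul_of_nonneg_right hΦ1 h2
      _ < ε / 2 := by rw [one_mul]; exact h1
  rw [Real.dist_eq, abs_lt]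
  constructor
  · linarith
  · have : markedProfile F ρ₁ ≤ markedProfile F ρ + markedProfile F ρ * (C * (ρ / ρ₁)) := by
      have e : markedProfile F ρ * (1 + C * (ρ / ρ₁)) = markedProfile F ρ + markedProfile F ρ * (C * (ρ / ρ₁)) := by ring
      linarith [hup, e.le]
    linarith

/-- **EXCLUSION AS ONE NUMBER**: `MarkedChunkExclusion F ⟺ Φ_∞(F) = 0`. -/
theorem markedChunkExclusion_iff_inf_eq_zero (F : SiteMarker) : MarkedChunkExclusion F ↔ markedProfileInf F = 0 := by
  constructor
  · intro h
    refine le_antisymm ?_ (markedProfileInf_nonneg F)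
    refine le_of_forall_gt_imp_ge_of_dense fun φ hφ => ?_
    obtain ⟨ρe, hρe⟩ := h φ hφ
    exact (markedProfileInf_le_markedProfile (le_max_right ρe 1)).trans
      (markedProfile_le_of_rung hφ.le (hρe _ (le_max_left _ _)))
  · intro h φ hφ
    have hev := (tendsto_markedProfile F).eventually (gt_mem_nhds (show markedProfileInf F < φ by rw [h]; exact hφ))
    obtain ⟨ρe, hρe⟩ := eventually_atTop.mp hev
    exact ⟨ρe, fun ρ hρ => noMarkedChunkAt_mono_phi (hρe ρ hρ).le (noMarkedChunkAt_markedProfile F ρ)⟩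

/-- **EVERY SINGLE RADIUS BOUNDS THE NUMBER** (loss-free): a rung at ONE radius `ρ ≥ 1` gives `Φ_∞(F) ≤ φ`. -/
theorem markedProfileInf_le_of_rung {F : SiteMarker} {ρ φ : ℝ} (hρ : 1 ≤ ρ) (hφ : 0 ≤ φ) (h : NoMarkedChunkAt F ρ φ) :
    markedProfileInf F ≤ φ :=
  (markedProfileInf_le_markedProfile hρ).trans (markedProfile_le_of_rung hφ h)

/-- **Exclusion ⟺ one radius per fraction** (loss-free, through the profile). -/
theorem markedChunkExclusion_iff_oneRadius (F : SiteMarker) : MarkedChunkExclusion F ↔ MarkedChunkExclusionAtOneRadius F := by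
  constructor
  · intro h φ hφ
    obtain ⟨ρe, hρe⟩ := h φ hφ
    exact ⟨max ρe 18, le_max_right _ _, hρe _ (le_max_left _ _)⟩
  · intro h
    rw [markedChunkExclusion_iff_inf_eq_zero]
    refine le_antisymm (le_of_forall_gt_imp_ge_of_dense fun φ hφ => ?_) (markedProfileInf_nonneg F)
    obtain ⟨ρ, hρ18, hX⟩ := h φ hφ
    exact markedProfileInf_le_of_rung (by linarith) hφ.le hX

/-- **`Φ_∞ < t` is WITNESSED at one finite radius**: `Φ_∞(F) < t ↔ ∃ ρ ≥ 1, Φ_F(ρ) < t`. -/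
theorem markedProfileInf_lt_iff {F : SiteMarker} {t : ℝ} : markedProfileInf F < t ↔ ∃ ρ : ℝ, 1 ≤ ρ ∧ markedProfile F ρ < t := by
  constructor
  · intro h
    obtain ⟨_, ⟨ρ, hρ, rfl⟩, hlt⟩ :=
      exists_lt_of_csInf_lt (⟨_, ⟨1, Set.mem_Ici.mpr le_rfl, rfl⟩⟩ : (markedProfile F '' Set.Ici 1).Nonempty) h
    exact ⟨ρ, hρ, hlt⟩
  · rintro ⟨ρ, hρ, hlt⟩
    exact lt_of_le_of_lt (markedProfileInf_le_markedProfile hρ) hlt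

/-- An open implant door at ONE radius `ρ ≥ 1` bounds the number: `Φ_∞(F) ≤ φ`. -/
theorem markedProfileInf_le_of_implantDoor {F : SiteMarker} {ρ φ : ℝ} (hρ : 1 ≤ ρ) (hφ : 0 ≤ φ) (h : MarkedImplantDoor F ρ φ) :
    markedProfileInf F ≤ φ :=
  markedProfileInf_le_of_rung hρ hφ (noMarkedChunkAt_of_implantDoor h)

/-- «`Φ_∞ < φ`» is WEAKER than exclusion at every `φ > 0`. -/
theorem dip_of_markedChunkExclusion {F : SiteMarker} {φ : ℝ} (hφ : 0 < φ) (h : MarkedChunkExclusion F) : markedProfileInf F < φ := by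
  rw [(markedChunkExclusion_iff_inf_eq_zero F).mp h]
  exact hφ

/-- The radius rung makes the profile VANISH at that radius, for every marker. -/
theorem markedProfile_eq_zero_of_noLooseChunkAt (F : SiteMarker) {r : ℝ} (h : NoLooseChunkAt r) : markedProfile F r = 0 :=
  le_antisymm (markedProfile_le_of_rung le_rfl (noMarkedChunkAt_zero_of_noLooseChunkAt F h)) (markedProfile_nonneg F r)

/-- NLC ⟹ `Φ_∞(F) = 0` for every marker. -/
theorem markedProfileInf_eq_zero_of_noLooseChunks (h : NoLooseChunks) (F : SiteMarker) : markedProfileInf F = 0 :=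
  (markedChunkExclusion_iff_inf_eq_zero F).mp (markedChunkExclusion_of_noLooseChunks h F)

end Summit.AtomisticToContinuum.Crystallization.Theorems.ContactSaturationLadderChunkDoor

end
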